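import Summits.ResolutionOfSingularities.ResolutionOfSingularities.Theorems.WildConesCampaignW46FormalChart
import Summits.ResolutionOfSingularities.ResolutionOfSingularities.Theorems.WildConesCampaignW46AtomGerm
import Literature.AlgebraicGeometry.Resolution.AdicCompletionRegular
import HarnessLib

/-!
# [OURS · L1 W4.6 rung (iii-2), NON-RATIONAL POINTS, brick 1] Formal-chart recognition at a NON-RATIONAL closed point of the point
# blow-up: the coefficient field grows (Hensel lift of the separable minimal polynomial of the point), and `π̂^♯` IS the chart
# substitution over the bigger field

Cell `res-hironaka`, LADDER-RESOLUTION rung L (D-0089), slot W4.6 rung (iii) «purely inseparable `z^p = f(x, y)` with `ord f < 2p`»;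
seat res-L1-s46-pv-6 (gen 7). Host route MarkedTransfer (`HypersurfaceOrderReduction`, stmt-ResolutionOfSingularities-16155),
`--supports … --as helper`; kind proof (no definition). Pure commutative algebra (Hensel's lemma in a complete local ring, Cohen
coefficient fields, complete Nakayama); NOTHING here is a statement of H. Hironaka's manuscript [Hironaka2017] and nothing of it is
used; no FACT-LIST premise. AI-written; AI review is weaker than expert review.

## Why (HOME/L/res-L1-s46-pv-6/GENERAL-REGIME-ANALYSIS.md §5; res-L1-s46-pv-2 residue (R1); res-L1-s46-pv-5 W-WALK-PLAN «open beyond: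
## perfect non-closed K»)

Every formal-chart brick of the W4.6 dictionary so far (res-L1-s46-pv-2 `FormalChart.exists_ringEquiv_chart`, `…FormalChartAssembly`;
this seat's `…FormalStepCore`, `…FormalInsepStepCore`) assumes the blown-up point is RESIDUALLY RATIONAL over its image (`hres`: every
germ upstairs is a germ from downstairs modulo `𝔪`). Over an infinite perfect NON-closed ground field the singular points of a stage need
not be rational, and a thread of singular points may pass through points whose residue fields GROW. This file is the recognition step
at such a point: the completed local ring upstairs is `κ′⟦X⟧` with `κ′ = κ(λ) ⊋ κ` the residue field of the point, and `π̂^♯` read in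
these coordinates is the chart substitution `X_y ↦ X_x (X_y + λ)` over `κ′` composed with the base change `κ⟦X⟧ → κ′⟦X⟧`.

## What is proved (all [folklore]; `K` a field, `C` a complete Noetherian local ring, `σ` finite)

* `ringHom_ext_of_apply_X_mem` — two ring maps `K⟦X_σ⟧ → C` sending the variables into `𝔪_C` and agreeing on constants and
  variables are equal (jets + Krull's intersection theorem).
* `ringHom_eq_subst_map_chartGerm` — a ring map `g : K⟦z, u⟧ → K′⟦z, u⟧` with `g ∘ C = C ∘ ι` (`ι : K → K′`) and the germ-chart values
  on the variables (`u_i ↦ u_i`, `u_j ↦ u_i (u_j + τ_j)`, `z ↦ u_i (z + r)`, `τ_j ∈ K′`, `r ∈ K′⟦u⟧`) IS `subst Ψ̂ ∘ map ι`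
  (res-L1-s46-pv-2's `AtomGerm.ringHom_eq_subst_chartGerm` one coefficient field up).
* `exists_root_of_separable` — HENSEL: `ι : K → C`, `π ∈ K[X]` irreducible monic over a perfect `K`, `a₀ ∈ C` with `π^ι(a₀) ∈ 𝔪_C`
  ⟹ a root `a ≡ a₀` of `π^ι` in `C` (the derivative is a unit at `a₀` by Bézout for the separable `π`).
* `exists_coeffField_adjoinRoot` — the COEFFICIENT FIELD GROWS: with such a root, `ι′ = AdjoinRoot.lift ι a : K(λ) := K[X]/(π) → C`
  extends `ι`, and if every element of `C` is a `K`-polynomial in `a₀` modulo `𝔪_C` then `ι′` maps onto the residue field of `C`.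
* `exists_ringEquiv_chart_nr` — **RECOGNITION AT A NON-RATIONAL POINT**: `φ : K⟦z, u₀, u₁⟧ → C` with `φ(X_j) = φ(X_{u_i}) · e_j`,
  `𝔪_C = (φ X_{u_i}, e_z, π^{φC}(e_{u_j}))` (`π` irreducible monic over the perfect field `K`: the minimal polynomial of the
  `u_j/u_i`-coordinate of the point; `e_z ∈ 𝔪_C`: the point lies on the line `z/u_i = 0` of the exceptional plane), every element
  of `C` a `K`-polynomial in `e_{u_j}` modulo `𝔪_C`, `dim C = 3`, and a cleaning shear `s ∈ K′⟦z, u⟧` (`z`-free, `s(0) = 0`)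
  ⟹ `E : C ≅ K′⟦z, u₀, u₁⟧`, `K′ = AdjoinRoot π`, with `E(φ(C l)) = C(l)`, `E(φ X_{u_i}) = X_{u_i}`,
  `E(φ X_{u_j}) = X_{u_i} (X_{u_j} + C λ)` (`λ = AdjoinRoot.root π`), `E(φ X_z) = X_{u_i} (X_z + s)`.

References: H. Matsumura, *Commutative Ring Theory* (1986), Thm. 8.3 (Hensel), Thm. 8.4, Thm. 28.3 (coefficient fields), Thm. 29.7;
The Stacks Project, Tags 04GM (Henselian), 0323 (Cohen structure); tree `WildConesCampaignW46FormalChart.lean`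
(`exists_ringEquiv_mvPowerSeries_of_generators`, `exists_algEquiv_shear`), `WildConesCampaignW46AtomGerm.lean` (`hasSubst_chartGerm`),
`Literature/RingTheory/MvPowerSeries/MaximalIdealPow.lean` (jets), Mathlib `IsAdicComplete.henselianRing`, `AdjoinRoot`. H. Hironaka,
ms. 2017, Th. 16.6 p.84 — ROLE of «the blowup `π : Z′ → Z`» only, under adjudication, not cited as fact. [Matsumura1987] [StacksProject]
[folklore]
-/

noncomputable section

set_option linter.dupNamespace false -- mandated namespace of this single-conjunct summit

open IsLocalRing MvPowerSeries

namespace Summit.ResolutionOfSingularities.ResolutionOfSingularities.Theorems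

namespace CampaignW46

namespace MohWindowShadeFormalNR

open CampaignW46.FormalChart (exists_ringEquiv_mvPowerSeries_of_generators exists_algEquiv_shear)
open CampaignW46.AtomGerm (hasSubst_chartGerm rename_chartSubst_self rename_chartSubst_of_ne)
open Literature.RingTheory.MvPowerSeries.Jets (mem_maximalIdeal_iff_constantCoeff_eq_zero sub_coe_truncTotal_mem_maximalIdeal_pow
  maximalIdeal_pow_eq_span_monomial exists_eq_sum_monomial_mul)
open Summit.ResolutionOfSingularities.ResolutionOfSingularities.Theorems.FrobeniusClosing (chartSubst)

/-! ## §1 Ring maps out of `K⟦X⟧` into a complete local ring are determined by constants and variables -/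

section Ext

variable {K : Type} [Field K] {σ : Type} [Fintype σ] {T : Type} [CommRing T] [IsLocalRing T] [IsNoetherianRing T]

omit [Fintype σ] in
/-- An exponent of degree one is a `single s 1`. [folklore] -/
theorem exists_eq_single_of_degree_eq_one (e : σ →₀ ℕ) (he : e.degree = 1) : ∃ s, e = Finsupp.single s 1 := by
  classical
  have hne : e ≠ 0 := by rintro rfl; simp at he
  obtain ⟨s, hs⟩ := Finsupp.ne_iff.mp hne
  simp only [Finsupp.coe_zero, Pi.zero_apply] at hs
  have h1 : Finsupp.single s 1 ≤ e := Finsupp.single_le_iff.2 (Nat.one_le_iff_ne_zero.2 hs)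
  refine ⟨s, ?_⟩
  have hsplit : e = Finsupp.single s 1 + (e - Finsupp.single s 1) := (add_tsub_cancel_of_le h1).symm
  have hdeg : (e - Finsupp.single s 1).degree = 0 := by
    have := congrArg Finsupp.degree hsplit
    rw [map_add, Finsupp.degree_single, he] at this
    omega
  rw [Finsupp.degree_eq_zero_iff] at hdeg
  rw [hsplit, hdeg, add_zero]

/-- For finitely many variables the maximal ideal of `K⟦X_σ⟧` is generated by the variables. [folklore] -/
theorem maximalIdeal_eq_span_range_X : maximalIdeal (MvPowerSeries σ K) = Ideal.span (Set.range (X : σ → MvPowerSeries σ K)) := by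
  classical
  apply le_antisymm
  · intro f hf
    have h0 : constantCoeff f = 0 := mem_maximalIdeal_iff_constantCoeff_eq_zero.1 hf
    obtain ⟨S, g, hS, rfl⟩ := exists_eq_sum_monomial_mul 1 f (fun e he => by
      have he0 : e = 0 := (Finsupp.degree_eq_zero_iff e).1 (by omega)
      rw [he0, coeff_zero_eq_constantCoeff_apply, h0])
    refine Ideal.sum_mem _ fun e he => Ideal.mul_mem_right _ _ ?_
    obtain ⟨s, rfl⟩ := exists_eq_single_of_degree_eq_one e (hS e he)
    rw [← X_def]
    exact Ideal.subset_span ⟨s, rfl⟩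
  · rw [Ideal.span_le]
    rintro _ ⟨s, rfl⟩
    exact mem_maximalIdeal_iff_constantCoeff_eq_zero.2 (constantCoeff_X s)

omit [IsNoetherianRing T] in
/-- A ring map `K⟦X_σ⟧ → T` sending every variable into `𝔪_T` maps `𝔪^N` into `𝔪_T^N`. [folklore] -/
theorem map_maximalIdeal_pow_le_of_apply_X_mem (φ : MvPowerSeries σ K →+* T) (hφ : ∀ s, φ (X s) ∈ maximalIdeal T) (N : ℕ) :
    (maximalIdeal (MvPowerSeries σ K) ^ N).map φ ≤ maximalIdeal T ^ N := by
  have h1 : (maximalIdeal (MvPowerSeries σ K)).map φ ≤ maximalIdeal T := by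
    rw [maximalIdeal_eq_span_range_X, Ideal.map_span, Ideal.span_le]
    rintro _ ⟨_, ⟨s, rfl⟩, rfl⟩
    exact hφ s
  rw [Ideal.map_pow]
  exact Ideal.pow_right_mono h1 N

/-- **Uniqueness of local ring maps out of a power series ring.** Two ring maps `K⟦X_σ⟧ → T` into a Noetherian local ring which
send the variables into `𝔪_T` and agree on the constants and on the variables are equal: they agree on polynomials, and the difference
on a series lies in `⋂_N 𝔪_T^N = 0` (Krull). [cite: Matsumura1987, Thm. 8.10] [folklore] -/
theorem ringHom_ext_of_apply_X_mem (φ ψ : MvPowerSeries σ K →+* T) (hφ : ∀ s, φ (X s) ∈ maximalIdeal T)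
    (hψ : ∀ s, ψ (X s) ∈ maximalIdeal T) (hC : ∀ l, φ (MvPowerSeries.C l) = ψ (MvPowerSeries.C l))
    (hX : ∀ s, φ (X s) = ψ (X s)) : φ = ψ := by
  classical
  have hpoly : φ.comp (MvPolynomial.coeToMvPowerSeries.ringHom (σ := σ) (R := K)) =
      ψ.comp (MvPolynomial.coeToMvPowerSeries.ringHom (σ := σ) (R := K)) := by
    refine MvPolynomial.ringHom_ext (fun l => ?_) (fun s => ?_)
    · simpa [MvPolynomial.coeToMvPowerSeries.ringHom_apply] using hC l
    · simpa [MvPolynomial.coeToMvPowerSeries.ringHom_apply] using hX s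
  refine RingHom.ext fun f => ?_
  rw [← sub_eq_zero, ← Ideal.mem_bot, ← Ideal.iInf_pow_eq_bot_of_isLocalRing (maximalIdeal T) (Ideal.IsPrime.ne_top inferInstance),
    Ideal.mem_iInf]
  intro N
  have hq : φ (↑(truncTotal N f)) = ψ (↑(truncTotal N f)) := by
    have := congrArg (fun χ => χ (truncTotal N f)) hpoly
    simpa [MvPolynomial.coeToMvPowerSeries.ringHom_apply] using this
  have hsplit : f = ↑(truncTotal N f) + (f - ↑(truncTotal N f)) := by ring
  rw [hsplit, map_add, map_add, hq, add_sub_add_left_eq_sub]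
  exact Ideal.sub_mem _ (map_maximalIdeal_pow_le_of_apply_X_mem φ hφ N (Ideal.mem_map_of_mem _ (sub_coe_truncTotal_mem_maximalIdeal_pow N f)))
    (map_maximalIdeal_pow_le_of_apply_X_mem ψ hψ N (Ideal.mem_map_of_mem _ (sub_coe_truncTotal_mem_maximalIdeal_pow N f)))

end Ext

/-! ## §2 The germ chart substitution one coefficient field up -/

section ChartGerm

variable {n : ℕ} {K K' : Type} [Field K] [Field K'] (ι : K →+* K')

/-- [OURS · L1 W4.6 — the germ chart ONE COEFFICIENT FIELD UP; replaces the role of «the blowup `π : Z′ → Z` with center `D`»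
(H. Hironaka, ms. 2017, Th. 16.6 p.84 l.4–8) on completed local rings at a NON-rational point; NOT a statement of the manuscript]
A ring map `g : K⟦z, u⟧ → K′⟦z, u⟧` with `g (C l) = C (ι l)` and the germ-chart values on the variables — `u_i ↦ u_i`,
`u_j ↦ u_i (u_j + τ_j)` (`τ_j ∈ K′`), `z ↦ u_i (z + r)` (`r ∈ K′⟦u⟧`) — IS the germ chart substitution `Ψ̂` over `K′` precomposed
with the coefficient extension `map ι`. [folklore] -/
theorem ringHom_eq_subst_map_chartGerm (g : MvPowerSeries (Option (Fin n)) K →+* MvPowerSeries (Option (Fin n)) K')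
    (hC : ∀ l, g (MvPowerSeries.C l) = MvPowerSeries.C (ι l)) (i : Fin n) (τ : Fin n → K') (r : MvPowerSeries (Fin n) K')
    (hi : g (X (some i)) = X (some i))
    (hj : ∀ j, j ≠ i → g (X (some j)) = X (some i) * (X (some j) + MvPowerSeries.C (τ j)))
    (hz : g (X none) = X (some i) * (X none + rename (some : Fin n → Option (Fin n)) r))
    (f : MvPowerSeries (Option (Fin n)) K) :
    g f = subst (fun o : Option (Fin n) => o.elim
      (X (some i) * (X none + rename (some : Fin n → Option (Fin n)) r))
      (fun j => rename (some : Fin n → Option (Fin n)) (chartSubst n K' i τ j))) (MvPowerSeries.map ι f) := by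
  classical
  set σ' : Option (Fin n) → MvPowerSeries (Option (Fin n)) K' := fun o => o.elim
      (X (some i) * (X none + rename (some : Fin n → Option (Fin n)) r))
      (fun j => rename (some : Fin n → Option (Fin n)) (chartSubst n K' i τ j)) with hσ'
  have hσ'sub : HasSubst σ' := hasSubst_chartGerm i τ r
  set ψ : MvPowerSeries (Option (Fin n)) K →+* MvPowerSeries (Option (Fin n)) K' :=
    (substAlgHom hσ'sub).toRingHom.comp (MvPowerSeries.map ι) with hψ
  have hψapp : ∀ f, ψ f = subst σ' (MvPowerSeries.map ι f) := fun f => by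
    rw [hψ, RingHom.comp_apply]; exact substAlgHom_apply hσ'sub _
  have hval : ∀ o, σ' o = g (X o) := by
    intro o
    cases o with
    | none => exact hz.symm
    | some j =>
      by_cases hji : j = i
      · subst hji; exact (rename_chartSubst_self j τ).trans hi.symm
      · exact (rename_chartSubst_of_ne i τ hji).trans (hj j hji).symm
  have hσ'𝔪 : ∀ o, σ' o ∈ maximalIdeal (MvPowerSeries (Option (Fin n)) K') := by
    intro o
    rw [mem_maximalIdeal_iff_constantCoeff_eq_zero]
    cases o with
    | none => simp [hσ']
    | some j =>
      simp only [hσ', Option.elim]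
      rw [AtomGerm.constantCoeff_rename_some]
      exact FrobeniusClosing.FactorizationProof.constantCoeff_chartSubst i τ j
  suffices h : g = ψ by rw [h, hψapp]
  haveI : IsNoetherianRing (MvPowerSeries (Option (Fin n)) K') :=
    (Literature.AlgebraicGeometry.Resolution.isRegularLocalRing_mvPowerSeries K' (Option (Fin n))).toIsNoetherian
  refine ringHom_ext_of_apply_X_mem g ψ (fun o => by rw [← hval]; exact hσ'𝔪 o) (fun o => ?_) (fun l => ?_) (fun o => ?_)
  · rw [hψapp, MvPowerSeries.map_X, subst_X hσ'sub]; exact hσ'𝔪 o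
  · rw [hC, hψapp, MvPowerSeries.map_C, subst_C]
  · rw [hψapp, MvPowerSeries.map_X, subst_X hσ'sub, hval]

end ChartGerm

/-! ## §3 Hensel: the coefficient field grows by the residue field of the point -/

section CoeffField

variable {K : Type} [Field K] {T : Type} [CommRing T] [IsLocalRing T] (ι : K →+* T)

omit [IsLocalRing T] in
/-- Congruent arguments give congruent values of a polynomial modulo an ideal (`a − b ∣ P(a) − P(b)`). [folklore] -/
theorem eval_sub_eval_mem {I : Ideal T} (P : Polynomial T) {a b : T} (hab : a - b ∈ I) : P.eval a - P.eval b ∈ I := by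
  obtain ⟨c, hc⟩ := Polynomial.sub_dvd_eval_sub a b P
  rw [hc]
  exact Ideal.mul_mem_right _ _ hab

/-- **HENSEL for the separable minimal polynomial of the point.** `π ∈ K[X]` irreducible and monic over a PERFECT field, `ι : K → T`
into a complete local ring, `a₀ ∈ T` with `π^ι(a₀) ∈ 𝔪_T` ⟹ the derivative `(π′)^ι(a₀)` is a unit (Bézout: `π` is separable) and there
is a root `a ≡ a₀ (mod 𝔪_T)` of `π^ι`. [cite: Matsumura1987, Thm. 8.3] [folklore] -/
theorem exists_root_of_irreducible [IsAdicComplete (maximalIdeal T) T] [PerfectField K] {π : Polynomial K} (hirr : Irreducible π)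
    (hm : π.Monic) (a₀ : T) (ha₀ : (π.map ι).eval a₀ ∈ maximalIdeal T) :
    IsUnit (((Polynomial.derivative π).map ι).eval a₀) ∧ ∃ a : T, (π.map ι).IsRoot a ∧ a - a₀ ∈ maximalIdeal T := by
  have hsep : π.Separable := PerfectField.separable_of_irreducible hirr
  obtain ⟨u, v, huv⟩ := hsep
  have hunit : IsUnit (((Polynomial.derivative π).map ι).eval a₀) := by
    have h1 : (u.map ι).eval a₀ * (π.map ι).eval a₀ + (v.map ι).eval a₀ * ((Polynomial.derivative π).map ι).eval a₀ = 1 := by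
      have := congrArg (fun q : Polynomial K => (q.map ι).eval a₀) huv
      simpa only [Polynomial.map_add, Polynomial.map_mul, Polynomial.map_one, Polynomial.eval_add, Polynomial.eval_mul,
        Polynomial.eval_one] using this
    have h2 : IsUnit ((v.map ι).eval a₀ * ((Polynomial.derivative π).map ι).eval a₀) := by
      have h3 : (v.map ι).eval a₀ * ((Polynomial.derivative π).map ι).eval a₀ = 1 - (u.map ι).eval a₀ * (π.map ι).eval a₀ := by
        rw [← h1]; ring
      rw [h3]
      exact IsLocalRing.isUnit_one_sub_self_of_mem_nonunits _ (Ideal.mul_mem_left _ _ ha₀)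
    exact isUnit_of_mul_isUnit_right h2
  refine ⟨hunit, ?_⟩
  have hH := (IsAdicComplete.henselianRing T (maximalIdeal T)).is_henselian (π.map ι) (hm.map ι) a₀ ha₀ ?_
  · exact hH
  · rw [Polynomial.derivative_map]
    exact hunit.map _

variable (π : Polynomial K) [Fact (Irreducible π)]

/-- **THE COEFFICIENT FIELD GROWS.** A root `a` of `π^ι` in `T` extends `ι : K → T` to `ι′ = AdjoinRoot.lift ι a : K(λ) → T`
(`K(λ) = K[X]/(π)`, `λ ↦ a`), with `ι′(P(λ)) = P^ι(a)`; if every element of `T` is a `K`-polynomial in some `a₀ ≡ a` modulo `𝔪_T`,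
then `ι′` maps ONTO the residue field of `T` (a coefficient field of the complete local ring `T`, Cohen). [cite: Matsumura1987, Thm. 28.3]
[folklore] -/
theorem exists_coeffField (a a₀ : T) (ha : (π.map ι).IsRoot a) (haa₀ : a - a₀ ∈ maximalIdeal T)
    (hres : ∀ c : T, ∃ P : Polynomial K, c - (P.map ι).eval a₀ ∈ maximalIdeal T) :
    ∃ ι' : AdjoinRoot π →+* T, (∀ l, ι' (AdjoinRoot.of π l) = ι l) ∧ ι' (AdjoinRoot.root π) = a ∧
      (∀ P : Polynomial K, ι' (AdjoinRoot.mk π P) = (P.map ι).eval a) ∧ ∀ c : T, ∃ l : AdjoinRoot π, c - ι' l ∈ maximalIdeal T := by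
  have hev : Polynomial.eval₂ ι a π = 0 := by rw [Polynomial.eval₂_eq_eval_map]; exact ha
  refine ⟨AdjoinRoot.lift ι a hev, fun l => AdjoinRoot.lift_of hev, AdjoinRoot.lift_root hev, fun P => ?_, fun c => ?_⟩
  · rw [AdjoinRoot.lift_mk, Polynomial.eval₂_eq_eval_map]
  · obtain ⟨P, hP⟩ := hres c
    refine ⟨AdjoinRoot.mk π P, ?_⟩
    rw [AdjoinRoot.lift_mk, Polynomial.eval₂_eq_eval_map]
    have e1 : c - (P.map ι).eval a = (c - (P.map ι).eval a₀) + ((P.map ι).eval a₀ - (P.map ι).eval a) := by ring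
    rw [e1]
    refine Ideal.add_mem _ hP (eval_sub_eval_mem _ ?_)
    rw [← neg_sub]; exact (Ideal.neg_mem_iff _).mpr haa₀

end CoeffField

/-! ## §4 Formal-chart recognition at a non-rational point of the exceptional plane -/

section Recognition

variable {K : Type} [Field K] [PerfectField K] {T : Type} [CommRing T] [IsLocalRing T] [IsNoetherianRing T]
  [IsAdicComplete (maximalIdeal T) T]

/-- [OURS · L1 W4.6 — DICTIONARY AT A NON-RATIONAL POINT, brick 1; replaces the role of «the blowup `π : Z′ → Z` with center `D`»
(H. Hironaka, ms. 2017, Th. 16.6 p.84 l.4–8) ON COMPLETED LOCAL RINGS AT A NON-RATIONAL CLOSED POINT of the exceptional plane; NOT a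
statement of the manuscript] **Formal-chart recognition at a non-rational point.** Let `φ : K⟦z, u₀, u₁⟧ → T` be a ring map into a
complete Noetherian local ring of dimension `3` (`z = X none`, `u_l = X (some l)`; in the application `φ = π̂^♯ ∘ E₀⁻¹`), `i₀ ≠ i₁` the
two `u`-indices, `e_j ∈ T` with `φ(X_j) = φ(X_{u_{i₀}}) · e_j` (the point lies in the chart `u_{i₀}`), `π ∈ K[X]` irreducible monic
(the minimal polynomial over `K` of the `u_{i₁}/u_{i₀}`-coordinate of the point; `K` perfect, so `π` is separable) with
`𝔪_T = (φ X_{u_{i₀}}, e_z, π^{φC}(e_{u_{i₁}}))` (`e_z ∈ 𝔪_T`: the point lies on the line `z = 0` of the exceptional plane), and suppose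
every element of `T` is a `K`-polynomial in `e_{u_{i₁}}` modulo `𝔪_T` (the residue field of `T` is `K(λ)`). Then for every cleaning
shear `s ∈ K′⟦z, u⟧` (`z`-free, `s(0) = 0`), `K′ = K(λ) = AdjoinRoot π`: `T ≅ K′⟦z, u₀, u₁⟧` by an `E` with `E ∘ φ ∘ C = C ∘ (K → K′)`,
`E(φ X_{u_{i₀}}) = X_{u_{i₀}}`, `E(φ X_{u_{i₁}}) = X_{u_{i₀}} (X_{u_{i₁}} + C λ)`, `E(φ X_z) = X_{u_{i₀}} (X_z + s)`.
[cite: Matsumura1987, Thm. 29.7] [cite: Matsumura1987, Thm. 28.3] [folklore] -/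
theorem exists_ringEquiv_chart_nr (φ : MvPowerSeries (Option (Fin 2)) K →+* T) {i₀ i₁ : Fin 2} (hi : i₁ ≠ i₀)
    (htwo : ∀ l : Fin 2, l = i₀ ∨ l = i₁) (e : Option (Fin 2) → T) (he : ∀ j, j ≠ some i₀ → φ (X j) = φ (X (some i₀)) * e j)
    (π : Polynomial K) [Fact (Irreducible π)] (hm : π.Monic)
    (hgen : Ideal.span {φ (X (some i₀)), e none, (π.map (φ.comp MvPowerSeries.C)).eval (e (some i₁))} = maximalIdeal T)
    (hres : ∀ c : T, ∃ P : Polynomial K, c - (P.map (φ.comp MvPowerSeries.C)).eval (e (some i₁)) ∈ maximalIdeal T)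
    (hdim : ringKrullDim T = 3) (s : MvPowerSeries (Option (Fin 2)) (AdjoinRoot π)) (hs0 : constantCoeff s = 0)
    (hs : subst (fun j : Option (Fin 2) => if j = none then (0 : MvPowerSeries (Option (Fin 2)) (AdjoinRoot π)) else X j) s = s) :
    ∃ E : T ≃+* MvPowerSeries (Option (Fin 2)) (AdjoinRoot π),
      (∀ l, E (φ (MvPowerSeries.C l)) = MvPowerSeries.C (AdjoinRoot.of π l)) ∧
      E (φ (X (some i₀))) = X (some i₀) ∧
      E (φ (X (some i₁))) = X (some i₀) * (X (some i₁) + MvPowerSeries.C (AdjoinRoot.root π)) ∧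
      E (φ (X none)) = X (some i₀) * (X none + s) := by
  classical
  set ι : K →+* T := φ.comp MvPowerSeries.C with hι
  -- the minimal polynomial vanishes at the point modulo `𝔪`
  have hπe : (π.map ι).eval (e (some i₁)) ∈ maximalIdeal T := by
    rw [← hgen]; exact Ideal.subset_span (by simp)
  -- Hensel lift of the coordinate and the grown coefficient field
  obtain ⟨-, a, ha, haa₀⟩ := exists_root_of_irreducible ι (Fact.out : Irreducible π) hm (e (some i₁)) hπe
  obtain ⟨ι', hι'of, hι'root, hι'mk, hι'res⟩ := exists_coeffField ι π a (e (some i₁)) ha haa₀ hres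
  -- recentred generators of `𝔪_T`
  set x : Option (Fin 2) → T := fun j => if j = some i₀ then φ (X (some i₀)) else if j = none then e none else e (some i₁) - a with hx
  have hxi₀ : x (some i₀) = φ (X (some i₀)) := by rw [hx]; exact if_pos rfl
  have hxz : x none = e none := by
    rw [hx]; dsimp only; rw [if_neg (Option.some_ne_none i₀).symm, if_pos rfl]
  have hxi₁ : x (some i₁) = e (some i₁) - a := by
    rw [hx]; dsimp only; rw [if_neg (fun h => hi (Option.some_injective _ h)), if_neg (Option.some_ne_none i₁)]
  have hgen' : Ideal.span (Set.range x) = maximalIdeal T := by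
    apply le_antisymm
    · rw [Ideal.span_le]
      rintro _ ⟨j, rfl⟩
      rw [SetLike.mem_coe]
      cases j with
      | none => rw [hxz, ← hgen]; exact Ideal.subset_span (by simp)
      | some l =>
        rcases htwo l with rfl | rfl
        · rw [hxi₀, ← hgen]; exact Ideal.subset_span (by simp)
        · rw [hxi₁, ← Ideal.neg_mem_iff, neg_sub]; exact haa₀
    · rw [← hgen, Ideal.span_le]
      have hxmem : ∀ j, x j ∈ Ideal.span (Set.range x) := fun j => Ideal.subset_span ⟨j, rfl⟩
      rintro t ht
      simp only [Set.mem_insert_iff, Set.mem_singleton_iff] at ht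
      rw [SetLike.mem_coe]
      rcases ht with rfl | rfl | rfl
      · rw [← hxi₀]; exact hxmem _
      · rw [← hxz]; exact hxmem _
      · -- `π^ι(e) = (e − a) · q(e)`
        have hfac := (Polynomial.mul_divByMonic_eq_iff_isRoot (p := π.map ι) (a := a)).mpr ha
        have h1 : (π.map ι).eval (e (some i₁)) = (e (some i₁) - a) * ((π.map ι) /ₘ (Polynomial.X - Polynomial.C a)).eval (e (some i₁)) := by
          conv_lhs => rw [← hfac]
          rw [Polynomial.eval_mul, Polynomial.eval_sub, Polynomial.eval_X, Polynomial.eval_C]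
        rw [h1, ← hxi₁]
        exact Ideal.mul_mem_right _ _ (hxmem _)
  have hdim' : ringKrullDim T = Fintype.card (Option (Fin 2)) := by rw [hdim]; simp
  obtain ⟨E₁, hE₁x, hE₁C⟩ := exists_ringEquiv_mvPowerSeries_of_generators ι' hι'res x hgen' hdim'
  obtain ⟨θ, hθz, hθj⟩ := exists_algEquiv_shear none s hs0 hs
  have hθC : ∀ l, θ (MvPowerSeries.C l) = MvPowerSeries.C l := fun l => by
    rw [MvPowerSeries.c_eq_algebraMap]; exact θ.commutes l
  refine ⟨E₁.trans θ.toRingEquiv, fun l => ?_, ?_, ?_, ?_⟩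
  · change θ (E₁ (φ (MvPowerSeries.C l))) = _
    have : φ (MvPowerSeries.C l) = ι' (AdjoinRoot.of π l) := by rw [hι'of]; rfl
    rw [this, hE₁C, hθC]
  · change θ (E₁ (φ (X (some i₀)))) = _
    rw [← hxi₀, hE₁x, hθj _ (Option.some_ne_none i₀)]
  · change θ (E₁ (φ (X (some i₁)))) = _
    have h1 : e (some i₁) = x (some i₁) + ι' (AdjoinRoot.root π) := by rw [hxi₁, hι'root]; ring
    rw [he _ (fun h => hi (Option.some_injective _ h)), map_mul, map_mul, ← hxi₀, hE₁x, h1, map_add, hE₁x, hE₁C, map_add,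
      hθj _ (Option.some_ne_none i₀), hθj _ (Option.some_ne_none i₁), hθC]
  · change θ (E₁ (φ (X none))) = _
    rw [he _ (Option.some_ne_none i₀).symm, map_mul, map_mul, ← hxi₀, hE₁x, ← hxz, hE₁x, hθj _ (Option.some_ne_none i₀), hθz]

end Recognition

/-! ## §5 Small algebra used by the non-rational step -/

section Small

/-- Two polynomials congruent coefficientwise modulo an ideal take congruent values at congruent points. [folklore] -/
theorem eval_sub_eval_mem_of_coeff {T : Type} [CommRing T] {I : Ideal T} {P Q : Polynomial T} (hPQ : ∀ n, P.coeff n - Q.coeff n ∈ I)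
    {a b : T} (hab : a - b ∈ I) : P.eval a - Q.eval b ∈ I := by
  have h1 : P.eval a - Q.eval a ∈ I := by
    rw [← Polynomial.eval_sub]
    have hmem : P - Q ∈ Ideal.map (Polynomial.C : T →+* Polynomial T) I := by
      rw [Ideal.mem_map_C_iff]; intro n; rw [Polynomial.coeff_sub]; exact hPQ n
    rw [Polynomial.eval_eq_sum_range]
    refine Ideal.sum_mem _ fun n _ => Ideal.mul_mem_right _ _ ?_
    exact (Ideal.mem_map_C_iff.mp hmem) n
  have h2 : Q.eval a - Q.eval b ∈ I := eval_sub_eval_mem Q hab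
  have e1 : P.eval a - Q.eval b = (P.eval a - Q.eval a) + (Q.eval a - Q.eval b) := by ring
  rw [e1]; exact Ideal.add_mem _ h1 h2

/-- The order of a power series is unchanged by an injective coefficient map. [folklore] -/
theorem order_map_of_injective {σ : Type*} {A B : Type*} [Semiring A] [Semiring B] (f : A →+* B) (hf : Function.Injective f)
    (φ : MvPowerSeries σ A) : (MvPowerSeries.map f φ).order = φ.order := by
  refine le_antisymm ?_ (MvPowerSeries.le_order_map f)
  by_cases hφ : φ = 0
  · subst hφ; simp
  · obtain ⟨d, hd, hdeg⟩ := MvPowerSeries.exists_coeff_ne_zero_and_order ((MvPowerSeries.ne_zero_iff_order_finite).mp hφ)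
    rw [← hdeg]
    refine MvPowerSeries.order_le ?_
    rw [MvPowerSeries.coeff_map]
    exact fun h => hd (hf (by rw [h, map_zero]))

end Small


end MohWindowShadeFormalNR

end CampaignW46

end Summit.ResolutionOfSingularities.ResolutionOfSingularities.Theorems

end
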